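import Mathlib
import Literature.NumberTheory.Automorphic.HilbertModularFormQExpansion
import Summits.Langlands.Langlands.Theorems.CapacityClassicalityHilbertIntegralOverconvergentIsCongruenceTransferUnconditional
import Summits.Langlands.Langlands.Theorems.CapacityClassicalityHilbertIntegralOverconvergentIsCongruenceStubSlashMul
import Summits.Langlands.Langlands.Theorems.CapacityClassicalityHilbertIntegralOverconvergentIsCongruenceStubSlashHolomorphic

/-!
# The transfer at function level: algebraic over Hilbert modular forms ⇒ weight-`k` law under some `Γ(𝔪)` (stub N5)

Stub N5 `stub_transfer_functions` of line Sketch-ideate-r1-k1 (section N, RESHAPE 10) for the crux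
`HilbertIntegralOverconvergentIsCongruence` (stmt-Langlands-8485): a holomorphic `g` on `ℍ^{Hom(F,ℝ)}` satisfying a
non-trivial relation `∑_{j ≤ D} F_j g^j = 0` with Hilbert modular forms `F_j ∈ M_{b_j}(Γ₁(𝔫))`, `b_j + jk = b_0`, satisfies
`g(γz) = J_k(γ, z) g(z)` for all `γ` in a principal congruence subgroup `Γ(𝔪)`, `𝔪 ≠ 0` — unconditionally (Serre's
congruence subgroup property is proved in the tree).  This is the INSTANCE of the landed abstract transfer
`transferAbstract` (`…TransferUnconditional.lean`): `L` = the ring of restrictions to `ℍ` of functions holomorphic on `ℍ`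
(a subring of `ℍ → ℂ`; a domain by the no-zero-divisors input `hnzd`, the identity theorem), `SL₂(𝓞 F)` acting by
`(γ • φ)(z) = φ(γ⁻¹ z)` (a `MulSemiringAction` by the action law `slm_moeb_mul`), automorphy cocycle
`J_b(γ) = (z ↦ J_b(γ⁻¹, z)) ∈ Lˣ` (`slm_autFactor_mul`, `autFactor_add`), `Γ = Γ₁(𝔫)`.
-/

set_option linter.dupNamespace false

noncomputable section

namespace Summit.Langlands.Langlands.Theorems.HilbertIntegralOverconvergentIsCongruence

open MeasureTheory Complex NumberField
open Literature.NumberTheory.Automorphic Literature.NumberTheory.Automorphic.HilbertModular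
open scoped MatrixGroups

variable {F : Type} [Field F] [NumberField F]

omit [NumberField F] in
/-- The identity matrix acts trivially: `moeb 1 z = z`. -/
theorem trf_moeb_one (z : Point F) : moeb (1 : SL(2, F)) z = z := by
  funext σ
  simp [moeb, denom]

/-- The automorphy factor of the identity is `1`. -/
theorem trf_autFactor_one (k : (F →+* ℝ) → ℤ) (z : Point F) : autFactor k (1 : SL(2, F)) z = 1 := by
  simp [autFactor, denom]

/-- **Stub N5 — `stub_transfer_functions`.** The TRANSFER at function level, unconditional: a holomorphic `g` on `ℍ`,
algebraic over the ring of Hilbert modular forms of a finite-index level `Γ₁(𝔫)` (a non-trivial relation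
`∑_{j ≤ D} F_j g^j = 0` on `ℍ`, `F_j ∈ M_{b_j}(Γ₁(𝔫))`, `b_j + j k = b_0`), is invariant of weight `k` under a principal
congruence subgroup `Γ(𝔪)`, `𝔪 ≠ 0`, given that holomorphic functions on `ℍ` have no zero divisors (`hnzd`): the landed
`transferAbstract` on the domain of holomorphic functions on `ℍ` with the slash action. [folklore] -/
theorem stub_transfer_functions (F : Type) [Field F] [NumberField F] [NumberField.IsTotallyReal F]
    (hd : 1 < Module.finrank ℚ F)
    (hnzd : ∀ f g : Point F → ℂ, IsHolomorphicOn F f → IsHolomorphicOn F g →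
      (∀ z ∈ halfSpace F, f z * g z = 0) → (∃ z ∈ halfSpace F, f z ≠ 0) → ∀ z ∈ halfSpace F, g z = 0)
    (𝔫 : Ideal (𝓞 F)) (hΓ : (Bianchi.Gamma1 𝔫 : Subgroup SL(2, 𝓞 F)).FiniteIndex) (k : (F →+* ℝ) → ℤ) (D : ℕ)
    (b : ℕ → (F →+* ℝ) → ℤ) (hb : ∀ j ≤ D, b j + j • k = b 0)
    (Fm : ℕ → Point F → ℂ) (hFm : ∀ j ≤ D, Fm j ∈ modularForms (Bianchi.Gamma1 𝔫) (b j))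
    (hFm0 : ∃ j ≤ D, ∃ z ∈ halfSpace F, Fm j z ≠ 0)
    (g : Point F → ℂ) (hg : IsHolomorphicOn F g)
    (hrel : ∀ z ∈ halfSpace F, ∑ j ∈ Finset.range (D + 1), Fm j z * g z ^ j = 0) :
    ∃ 𝔪 : Ideal (𝓞 F), 𝔪 ≠ ⊥ ∧ ∀ γ ∈ Bianchi.Gamma 𝔪, ∀ z ∈ halfSpace F,
      g (moeb (toSL2F γ) z) = autFactor k (toSL2F γ) z * g z := by
  classical
  -- the ring `R` of all functions on `ℍ` and the restriction map
  set res : (Point F → ℂ) → (halfSpace F → ℂ) := fun f z ↦ f z with hres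
  have res_apply : ∀ (f : Point F → ℂ) (z : halfSpace F), res f z = f z := fun _ _ ↦ rfl
  -- the subring of restrictions of holomorphic functions
  let S : Subring (halfSpace F → ℂ) :=
    { carrier := {φ | ∃ f : Point F → ℂ, IsHolomorphicOn F f ∧ φ = res f}
      mul_mem' := by
        rintro _ _ ⟨f, hf, rfl⟩ ⟨f', hf', rfl⟩
        exact ⟨f * f', DifferentiableOn.mul hf hf', rfl⟩
      one_mem' := ⟨1, differentiableOn_const 1, rfl⟩
      add_mem' := by
        rintro _ _ ⟨f, hf, rfl⟩ ⟨f', hf', rfl⟩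
        exact ⟨f + f', DifferentiableOn.add hf hf', rfl⟩
      zero_mem' := ⟨0, differentiableOn_const 0, rfl⟩
      neg_mem' := by
        rintro _ ⟨f, hf, rfl⟩
        exact ⟨-f, DifferentiableOn.neg hf, rfl⟩ }
  have mem_S : ∀ {f : Point F → ℂ}, IsHolomorphicOn F f → res f ∈ S := fun {f} hf ↦ ⟨f, hf, rfl⟩
  -- a base point of `ℍ`
  set z₀ : Point F := fun _ ↦ I with hz₀def
  have hz₀ : z₀ ∈ halfSpace F := fun σ ↦ by simp [hz₀def]
  -- `S` is a domain
  haveI : Nontrivial S := ⟨⟨0, 1, fun h ↦ by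
    have := congrArg (fun x : S ↦ (x : halfSpace F → ℂ) ⟨z₀, hz₀⟩) h
    simp at this⟩⟩
  haveI : NoZeroDivisors S := ⟨by
    rintro ⟨_, f, hf, rfl⟩ ⟨_, f', hf', rfl⟩ h
    have hprod : ∀ z ∈ halfSpace F, f z * f' z = 0 := by
      intro z hz
      have := congrArg (fun x : S ↦ (x : halfSpace F → ℂ) ⟨z, hz⟩) h
      simpa using this
    by_cases hf0 : ∃ z ∈ halfSpace F, f z ≠ 0
    · right
      have hz : ∀ z ∈ halfSpace F, f' z = 0 := hnzd f f' hf hf' hprod hf0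
      ext ⟨z, hz'⟩
      simpa [hres] using hz z hz'
    · left
      push Not at hf0
      ext ⟨z, hz'⟩
      simpa [hres] using hf0 z hz'⟩
  haveI : IsDomain S := NoZeroDivisors.to_isDomain S
  -- the slash action of `SL₂(𝓞 F)` on `S`: `(γ • φ)(z) = φ(γ⁻¹ z)`
  have hmem : ∀ (γ : SL(2, 𝓞 F)) (z : halfSpace F), moeb (toSL2F γ) (z : Point F) ∈ halfSpace F :=
    fun γ z ↦ slm_moeb_mem_halfSpace (toSL2F γ) z.2
  let act : SL(2, 𝓞 F) → S → S := fun γ x ↦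
    ⟨fun z ↦ (x : halfSpace F → ℂ) ⟨moeb (toSL2F γ⁻¹) z, hmem γ⁻¹ z⟩, by
      obtain ⟨f, hf, hx⟩ := x.2
      refine ⟨fun w ↦ f (moeb (toSL2F γ⁻¹) w), slh_differentiableOn_comp_moeb _ hf, ?_⟩
      funext z
      simp [hx, hres]⟩
  have act_apply : ∀ (γ : SL(2, 𝓞 F)) (x : S) (z : halfSpace F),
      (act γ x : halfSpace F → ℂ) z = (x : halfSpace F → ℂ) ⟨moeb (toSL2F γ⁻¹) z, hmem γ⁻¹ z⟩ :=
    fun _ _ _ ↦ rfl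
  letI instSMul : SMul SL(2, 𝓞 F) S := ⟨act⟩
  have smul_apply : ∀ (γ : SL(2, 𝓞 F)) (x : S) (z : halfSpace F),
      ((γ • x : S) : halfSpace F → ℂ) z = (x : halfSpace F → ℂ) ⟨moeb (toSL2F γ⁻¹) z, hmem γ⁻¹ z⟩ :=
    fun _ _ _ ↦ rfl
  -- evaluation congruence for elements of `S`
  have eval_congr : ∀ (x : S) {w w' : halfSpace F}, (w : Point F) = w' →
      (x : halfSpace F → ℂ) w = (x : halfSpace F → ℂ) w' := fun x {w w'} h ↦ by rw [Subtype.ext h]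
  letI instAction : MulSemiringAction SL(2, 𝓞 F) S :=
    { one_smul := fun x ↦ by
        apply Subtype.ext; funext z
        rw [smul_apply]
        exact eval_congr x (by
          show moeb (toSL2F (1 : SL(2, 𝓞 F))⁻¹) (z : Point F) = z
          rw [inv_one, map_one, trf_moeb_one])
      mul_smul := fun γ δ x ↦ by
        apply Subtype.ext; funext z
        rw [smul_apply, smul_apply, smul_apply]
        exact eval_congr x (by
          show moeb (toSL2F (γ * δ)⁻¹) (z : Point F) = moeb (toSL2F δ⁻¹) (moeb (toSL2F γ⁻¹) (z : Point F))
          rw [mul_inv_rev, map_mul, slm_moeb_mul _ _ z.2])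
      smul_zero := fun γ ↦ by apply Subtype.ext; funext z; rw [smul_apply]; rfl
      smul_add := fun γ x y ↦ by apply Subtype.ext; funext z; rw [smul_apply]; rfl
      smul_one := fun γ ↦ by apply Subtype.ext; funext z; rw [smul_apply]; rfl
      smul_mul := fun γ x y ↦ by apply Subtype.ext; funext z; rw [smul_apply]; rfl }
  -- the automorphy cocycle with values in the units of `S`
  have hne : ∀ (c : (F →+* ℝ) → ℤ) (γ : SL(2, 𝓞 F)) (z : halfSpace F), autFactor c (toSL2F γ) z ≠ 0 :=
    fun c γ z ↦ autFactor_ne_zero c _ z.2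
  have hinvhol : ∀ (c : (F →+* ℝ) → ℤ) (γ : SL(2, 𝓞 F)),
      IsHolomorphicOn F (fun z ↦ (autFactor c (toSL2F γ) z)⁻¹) := fun c γ ↦
    (slh_differentiableOn_autFactor c (toSL2F γ)).inv fun z hz ↦ autFactor_ne_zero c _ hz
  let J : ((F →+* ℝ) → ℤ) → SL(2, 𝓞 F) → Sˣ := fun c γ ↦
    { val := ⟨res (autFactor c (toSL2F γ⁻¹)), mem_S (slh_differentiableOn_autFactor c _)⟩
      inv := ⟨res (fun z ↦ (autFactor c (toSL2F γ⁻¹) z)⁻¹), mem_S (hinvhol c γ⁻¹)⟩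
      val_inv := by
        apply Subtype.ext; funext z
        exact mul_inv_cancel₀ (hne c γ⁻¹ z)
      inv_val := by
        apply Subtype.ext; funext z
        exact inv_mul_cancel₀ (hne c γ⁻¹ z) }
  have J_apply : ∀ (c : (F →+* ℝ) → ℤ) (γ : SL(2, 𝓞 F)) (z : halfSpace F),
      ((J c γ : S) : halfSpace F → ℂ) z = autFactor c (toSL2F γ⁻¹) z := fun _ _ _ ↦ rfl
  have J_inv_apply : ∀ (c : (F →+* ℝ) → ℤ) (γ : SL(2, 𝓞 F)) (z : halfSpace F),
      (((J c γ)⁻¹ : Sˣ) : halfSpace F → ℂ) z = (autFactor c (toSL2F γ⁻¹) z)⁻¹ := fun _ _ _ ↦ rfl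
  have mul_apply_S : ∀ (x y : S) (z : halfSpace F),
      ((x * y : S) : halfSpace F → ℂ) z = (x : halfSpace F → ℂ) z * (y : halfSpace F → ℂ) z := fun _ _ _ ↦ rfl
  have hJ : ∀ (c c' : (F →+* ℝ) → ℤ) (γ : SL(2, 𝓞 F)), J (c + c') γ = J c γ * J c' γ := by
    intro c c' γ
    apply Units.ext; apply Subtype.ext; funext z
    rw [Units.val_mul, mul_apply_S, J_apply, J_apply, J_apply]
    exact autFactor_add c c' _ z.2
  have hJcoc : ∀ (c : (F →+* ℝ) → ℤ) (γ γ' : SL(2, 𝓞 F)), (J c (γ * γ') : S) = J c γ * γ • (J c γ' : S) := by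
    intro c γ γ'
    apply Subtype.ext; funext z
    rw [mul_apply_S, J_apply, J_apply, smul_apply, J_apply, mul_inv_rev, map_mul,
      slm_autFactor_mul c _ _ z.2, mul_comm]
  -- the coefficients and the unknown as elements of `S`
  let Fm' : ℕ → S := fun j ↦ if h : j ≤ D then ⟨res (Fm j), mem_S (hFm j h).holomorphic⟩ else 0
  have Fm'_apply : ∀ j, j ≤ D → ∀ z : halfSpace F, ((Fm' j : S) : halfSpace F → ℂ) z = Fm j z := by
    intro j hj z
    simp only [Fm', dif_pos hj, res_apply]
  let g' : S := ⟨res g, mem_S hg⟩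
  have g'_apply : ∀ z : halfSpace F, ((g' : S) : halfSpace F → ℂ) z = g z := fun _ ↦ rfl
  have hFm' : ∀ j ≤ D, ∀ γ ∈ Bianchi.Gamma1 𝔫, γ • Fm' j = (J (b j) γ : S) * Fm' j := by
    intro j hj γ hγ
    apply Subtype.ext; funext z
    rw [smul_apply, mul_apply_S, J_apply, Fm'_apply j hj, Fm'_apply j hj]
    exact (hFm j hj).transform γ⁻¹ (inv_mem hγ) z z.2
  have hFm0' : ∃ j ≤ D, Fm' j ≠ 0 := by
    obtain ⟨j, hj, z, hz, hne0⟩ := hFm0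
    refine ⟨j, hj, fun h0 ↦ hne0 ?_⟩
    have := congrArg (fun x : S ↦ (x : halfSpace F → ℂ) ⟨z, hz⟩) h0
    simpa [Fm'_apply j hj] using this
  have pow_apply_S : ∀ (x : S) (n : ℕ) (z : halfSpace F),
      ((x ^ n : S) : halfSpace F → ℂ) z = ((x : halfSpace F → ℂ) z) ^ n := by
    intro x n z
    induction n with
    | zero => rfl
    | succ n ih => rw [pow_succ, mul_apply_S, ih, pow_succ]
  have sum_apply_S : ∀ (u : Finset ℕ) (x : ℕ → S) (z : halfSpace F),
      ((∑ j ∈ u, x j : S) : halfSpace F → ℂ) z = ∑ j ∈ u, (x j : halfSpace F → ℂ) z := by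
    intro u x z
    induction u using Finset.induction_on with
    | empty => rfl
    | insert a u ha ih => rw [Finset.sum_insert ha, Finset.sum_insert ha, ← ih]; rfl
  have hrel' : ∑ j ∈ Finset.range (D + 1), Fm' j * g' ^ j = 0 := by
    apply Subtype.ext; funext z
    rw [sum_apply_S]
    have : ∀ j ∈ Finset.range (D + 1), ((Fm' j * g' ^ j : S) : halfSpace F → ℂ) z = Fm j z * g z ^ j := by
      intro j hj
      have hjD : j ≤ D := Nat.lt_succ_iff.mp (Finset.mem_range.mp hj)
      rw [mul_apply_S, pow_apply_S, Fm'_apply j hjD, g'_apply]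
    rw [Finset.sum_congr rfl this]
    exact hrel z z.2
  -- the abstract transfer
  obtain ⟨𝔪, h𝔪, hfix⟩ := transferAbstract F hd (L := S) (Bianchi.Gamma1 𝔫) hΓ J hJ hJcoc k D b hb Fm' hFm' hFm0'
    g' hrel'
  refine ⟨𝔪, h𝔪, fun γ hγ z hz ↦ ?_⟩
  have h := congrArg (fun x : S ↦ (x : halfSpace F → ℂ) ⟨z, hz⟩) (hfix γ⁻¹ (inv_mem hγ))
  rw [mul_apply_S, J_inv_apply, smul_apply, inv_inv] at h
  rw [g'_apply, g'_apply] at h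
  have hne' : autFactor k (toSL2F γ) z ≠ 0 := autFactor_ne_zero k _ hz
  calc g (moeb (toSL2F γ) z)
      = autFactor k (toSL2F γ) z * ((autFactor k (toSL2F γ) z)⁻¹ * g (moeb (toSL2F γ) z)) := by
        rw [← mul_assoc, mul_inv_cancel₀ hne', one_mul]
    _ = autFactor k (toSL2F γ) z * g z := by rw [h]

end Summit.Langlands.Langlands.Theorems.HilbertIntegralOverconvergentIsCongruence
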